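import Literature.NumberTheory.QuadraticFields.ReducedForms
import Mathlib.Tactic.Linarith
import HarnessLib

/-!
# The number of reduced forms of discriminant `D < 0` is at most `|D|`

For the tree's reduced primitive positive definite forms (`reducedForms D`, Cox §2.A) and class
number `classNumber D = #reducedForms D` (Cox Thm. 2.13) we prove the crude bound

  `classNumber D ≤ |D|`      (`classNumber_le_natAbs`),

from `3a² ≤ −D` for a reduced form `(a, b, c)` (Cox (2.12), `three_mul_sq_le_of_isReduced`):
a reduced form is determined by `(a, b)` with `1 ≤ a ≤ A = ⌊√(|D|/3)⌋`, `|b| ≤ A`, and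
`A (2A + 1) ≤ |D|`. This is the bound `#C_Δ < |Δ|` ((2.3) of Lenstra–Pomerance, J. Amer. Math.
Soc. **5** (1992) p. 487) by which "the longest strictly increasing chain of proper subgroups of
`C_Δ` has length at most `[(log |Δ|)/log 2]`" in the proof of their Theorem 4.5 (cf.
`Literature.GroupTheory.FiniteAbelian.length_le_log_card_of_chain`). (The sharper
`#C_Δ ≤ √|Δ| log |Δ|`, (2.13) there, needs the class number formula and is not proved here.)
Everything is proved.

## References

* D. A. Cox, *Primes of the form x² + ny²*, 2nd ed., §2.A, eq. (2.12) and Thm. 2.13. [Cox2013]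
* H. W. Lenstra Jr., C. Pomerance, J. Amer. Math. Soc. 5 (1992) 483–516, §2 (2.3) and §4 (proof of
  Thm 4.5). [LenstraPomerance1992]
-/

namespace Literature.NumberTheory.QuadraticFields.BinaryQuadraticForm

open Finset

/-- Cox (2.12): a reduced form `(a, b, c)` of discriminant `D` with `a > 0` has `3a² ≤ −D`
(`b² ≤ a²` and `a ≤ c` give `−D = 4ac − b² ≥ 3a²`). [cite: Cox2013, §2.A eq. (2.12)] -/
theorem three_mul_sq_le_of_isReduced {D a b c : ℤ} (hdisc : discr (a, b, c) = D) (ha : 0 < a)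
    (hred : IsReduced (a, b, c)) : 3 * a ^ 2 ≤ -D := by
  obtain ⟨h1, h2, h3, -⟩ := hred
  simp only at h1 h2 h3
  rw [discr_apply] at hdisc
  have hb : b ^ 2 ≤ a ^ 2 := by nlinarith
  nlinarith

/-- A reduced form of discriminant `D < 0` is determined by its first two coefficients.
[folklore] -/
theorem eq_of_mem_reducedForms_of_fst_eq {D : ℤ} (hD : D < 0) {Q Q' : ℤ × ℤ × ℤ}
    (hQ : Q ∈ reducedForms D) (hQ' : Q' ∈ reducedForms D) (h1 : Q.1 = Q'.1) (h2 : Q.2.1 = Q'.2.1) :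
    Q = Q' := by
  obtain ⟨a, b, c⟩ := Q
  obtain ⟨a', b', c'⟩ := Q'
  simp only at h1 h2
  subst h1
  subst h2
  obtain ⟨hdisc, ha, -, -⟩ := (mem_reducedForms_iff hD).1 hQ
  obtain ⟨hdisc', -, -, -⟩ := (mem_reducedForms_iff hD).1 hQ'
  simp only at ha
  rw [discr_apply] at hdisc hdisc'
  have : 4 * a * c = 4 * a * c' := by linarith
  have hc : c = c' := mul_left_cancel₀ (by positivity) this
  rw [hc]

/-- **`h(D) ≤ |D|`** for `D < 0`: the number of reduced primitive positive definite forms of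
discriminant `D` is at most `|D|` (the bound `#C_Δ < |Δ|` of [LP92, (2.3)]).
[cite: LenstraPomerance1992, §2 (2.3)] -/
theorem classNumber_le_natAbs {D : ℤ} (hD : D < 0) : classNumber D ≤ D.natAbs := by
  set N : ℕ := D.natAbs with hN
  set A : ℕ := Nat.sqrt (N / 3) with hA
  have hNZ : (N : ℤ) = -D := Int.ofNat_natAbs_of_nonpos hD.le
  -- every reduced form has `1 ≤ a ≤ A`, `-A ≤ b ≤ A`
  have hbounds : ∀ Q ∈ reducedForms D,
      (1 ≤ Q.1 ∧ Q.1 ≤ A) ∧ (-(A : ℤ) ≤ Q.2.1 ∧ Q.2.1 ≤ A) := by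
    intro Q hQ
    obtain ⟨a, b, c⟩ := Q
    obtain ⟨hdisc, ha, -, hred⟩ := (mem_reducedForms_iff hD).1 hQ
    simp only at ha ⊢
    have h3 := three_mul_sq_le_of_isReduced hdisc ha hred
    obtain ⟨hb1, hb2, -, -⟩ := hred
    simp only at hb1 hb2
    -- `a ≤ A`: `(a.toNat)² ≤ N / 3`
    have haA : a ≤ A := by
      have ha' : (a.toNat : ℤ) = a := Int.toNat_of_nonneg ha.le
      have hsq : a.toNat * a.toNat ≤ N / 3 := by
        rw [Nat.le_div_iff_mul_le (by norm_num)]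
        have : (((a.toNat * a.toNat * 3 : ℕ)) : ℤ) ≤ N := by push_cast; rw [ha', hNZ]; linarith
        exact_mod_cast this
      have : a.toNat ≤ A := Nat.le_sqrt.2 hsq
      calc a = (a.toNat : ℤ) := ha'.symm
        _ ≤ A := by exact_mod_cast this
    exact ⟨⟨by omega, haA⟩, by linarith, by linarith⟩
  -- inject into the rectangle
  have hcard : classNumber D ≤ #((Icc (1 : ℤ) A) ×ˢ (Icc (-(A : ℤ)) A)) := by
    rw [classNumber]
    refine card_le_card_of_injOn (fun Q => (Q.1, Q.2.1)) (fun Q hQ => ?_) ?_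
    · have h := hbounds Q hQ
      rw [mem_coe, mem_product, mem_Icc, mem_Icc]
      exact h
    · intro Q hQ Q' hQ' h
      simp only [Prod.mk.injEq] at h
      exact eq_of_mem_reducedForms_of_fst_eq hD hQ hQ' h.1 h.2
  -- count the rectangle: `A (2A + 1) ≤ N`
  have hrect : #((Icc (1 : ℤ) A) ×ˢ (Icc (-(A : ℤ)) A)) = A * (2 * A + 1) := by
    rw [card_product, Int.card_Icc, Int.card_Icc]
    have e1 : ((A : ℤ) + 1 - 1).toNat = A := by simp
    have e2 : ((A : ℤ) + 1 - -(A : ℤ)).toNat = 2 * A + 1 := by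
      rw [show (A : ℤ) + 1 - -(A : ℤ) = ((2 * A + 1 : ℕ) : ℤ) by push_cast; ring, Int.toNat_natCast]
    rw [e1, e2]
  have hAA : A * A ≤ N / 3 := by
    have h := Nat.sqrt_le' (N / 3)
    rw [sq] at h
    exact h
  have hfin : A * (2 * A + 1) ≤ N := by
    have h1 : A ≤ N / 3 := by
      rcases Nat.eq_zero_or_pos A with h0 | hpos
      · rw [h0]; exact Nat.zero_le _
      · exact (Nat.le_mul_of_pos_left A hpos).trans hAA
    have h2 : 3 * (N / 3) ≤ N := Nat.mul_div_le N 3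
    nlinarith
  exact hcard.trans (hrect.le.trans hfin)

end Literature.NumberTheory.QuadraticFields.BinaryQuadraticForm
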